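import Summits.HodgeConjecture.HodgeConjecture.Theorems.F0P3cStCharTSShellOrbitalGLocConst   -- ★ p849625 (this seat) (p2): `eventually_classOrbitalIntegral_congr_eq`; brings ★ (4.9.4) frame
import Literature.NumberTheory.Automorphic.CMTorusRegularAEPrelims              -- ★ `continuous_coe_torusEntry_inv_mul`, `isClosed_torusU_of_t1Space`
import Literature.NumberTheory.Automorphic.CMPrincipalSeriesSpherical           -- ★ `rootDeltaChar_borel_eq_one_of_mem_isCompact`
import Literature.NumberTheory.Automorphic.LocalRingUnitModulusProduct          -- ★ `unitModulusChar_localRing_eq_prod`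
import Literature.NumberTheory.Automorphic.AddCharConductorExponent             -- ★ `normAbs_eq_inv_zpow_of_valued_eq`
import Literature.NumberTheory.Automorphic.UnitaryGroupRegularTwistModulus      -- ★ `exists_conjLocal_skew_unit`
import Literature.NumberTheory.Automorphic.OrbitalIntegralChartRealisation      -- ★ `classOrbitalIntegral_mk_eq_zero_of_forall_conj_notMem_tsupport`
import Literature.Topology.LocallyConstantOfEventuallyEqOffCompact              -- ★ p849642 (this seat) (p4): the glue
import HarnessLib

/-!
# F0 · P3c · line LH6 «StCharTS» — road (D), brick D3-ii (B-ii): THE PRODUCER of the locally constant, compactly supported representative `Ψ` of the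
# normalised canonical orbital integral along the split torus (discharges `Ψ hΨlc hΨK hΨ ∕ hpt` of ★ `F0P3cStCharTSShellOrbitalG` p849606)

Cell `pub/hodgecm-mathlib`, crux H413 = `stmt-HodgeConjecture-24833` (lane `--supports … --as helper`); seat LH2-p03 (g3); road (D) owner LH6-p04 (g2), dealer
F0P3b-plan (g23) (ROAD-D v4 § (c₄)).  THEOREMS ONLY, sorry-free, ★-only imports.  HONEST LABEL: HC_CM is proved only modulo the 7 printed citations (2 remaining:
hLiu418 = stmt-HodgeConjecture-24832, h413 = stmt-HodgeConjecture-24833) until rung 0 closes; count-neutral.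

THE MATHEMATICS ([Rogawski1990, §4.9 p. 55; §12.5 p. 183]; [HarishChandra1970, Part V §§2–3]).  Fix the (4.9.4) frame `e : U(Φ₃)(L⁺_v) ≃ U(H)(L⁺_v)`, a canonical
family `m_G`, `f ∈ C_c^∞`.  On the diagonal torus `M` write `t = diag(d_t)` canonically (`d_t i := torusEntry i t`, §2), `δ(t) = δ_B^{1/2}(t)`,
`J₃(t) = (|d₀⁻¹d₁ − 1| · χ⁻(d₀⁻¹d₂ − 1))⁻¹` (defined where both arguments are units) and `O(t) = O_{⟦e t⟧}(f)`.  Suppose `S ⊆ M` is COMPACT OPEN, every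
`t ∈ S` has `e t` regular semisimple and `d₀⁻¹d₁ − 1`, `d₀⁻¹d₂ − 1` units, and for `t ∉ S` no conjugate of `e t` meets `tsupport f`.  Then
`Ψ(t) := δ(t) · J₃(t)⁻¹ · O(t)` (with `J₃ := 1` off the unit locus) is LOCALLY CONSTANT and COMPACTLY SUPPORTED, and satisfies the Φ-clause of ★ (4.9.4)
POINTWISE at every `t` and every diagonal writing `d` of `t` (`exists_normalizedOrbitalIntegral_isLocallyConstant_hasCompactSupport`).  Ingredients: `O` is
eventually constant at regular points (★ p849625); `δ = 1` on the compact subgroup `M ∩ K_v`, so `δ` is locally constant (§3); `|·|` and `χ⁻` of a unit of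
`∏_{w∣v} L_w` depend only on its valuation vector (§1: ★ `unitModulusChar_localRing_eq_prod`, ★ `normAbs_eq_inv_zpow_of_valued_eq`, ★ `skewModulus_eq_sqrt`),
which is locally constant at units (Mathlib `Valued.locally_const`, §2); `O = 0` off `S` (★ `classOrbitalIntegral_mk_eq_zero_of_forall_conj_notMem_tsupport`);
glue ★ p849642.  For the shell indicator `f = 𝟙_{K_n b K_n}` the set `S` is supplied by ★ D3-i `F0P3cStCharTSShellRoots` (valuation pattern of `b` or `bʷ`).

## References
* [Rogawski1990] J. D. Rogawski, *Automorphic Representations of Unitary Groups in Three Variables*, Ann. of Math. Stud. 123 (1990), §4.9 pp. 54–56; §12.5 p. 183.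
* [HarishChandra1970] Harish-Chandra, *Harmonic analysis on reductive p-adic groups*, LNM 162 (1970), Part V §§2–3 (local constancy of orbital integrals at regular elements).
* [WeilBNT1967] A. Weil, *Basic Number Theory* (1967), Ch. I §2, §4 (the module of an automorphism of a local field).
-/

set_option autoImplicit false
set_option linter.dupNamespace false

noncomputable section

open NumberField IsDedekindDomain MeasureTheory Topology Filter Set
open scoped Matrix MatrixGroups NNReal
open Literature.MeasureTheory.Group Literature.NumberTheory.Automorphic Literature.NumberTheory.Automorphic.UnitaryGroup
open Literature.NumberTheory.Rogawski1990

namespace Summit.HodgeConjecture.HodgeConjecture.Cruxes.H413.F0P3cStCharTSShellOrbitalG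

variable (L : Type) [Field L] [NumberField L] [IsCMField L]

/-! ## §1 The module and the skew module of a unit of `∏_{w∣v} L_w` depend only on its valuation vector -/

omit [IsCMField L] in
/-- A unit of `∏_{w∣v} L_w` has non-zero valuation at every place. [cite: WeilBNT1967, Ch. I §2] -/
theorem valued_apply_ne_zero_of_isUnit (v : HeightOneSpectrum (𝓞 ↥(maximalRealSubfield L))) {x : LocalRing L v} (hx : IsUnit x)
    (w' : PlacesOver L v) : Valued.v (x w') ≠ 0 := by
  obtain ⟨u, rfl⟩ := hx
  have h1 : ((u : LocalRing L v) w') * (((u⁻¹ : (LocalRing L v)ˣ) : LocalRing L v) w') = 1 := by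
    rw [← Pi.mul_apply, Units.mul_inv, Pi.one_apply]
  exact (Valuation.ne_zero_iff _).2 (left_ne_zero_of_mul_eq_one h1)

omit [IsCMField L] in
/-- A vector with the valuation vector of a unit is a unit (`∏_{w∣v} L_w` is a product of fields). [cite: WeilBNT1967, Ch. I §2] -/
theorem isUnit_of_valued_apply_eq (v : HeightOneSpectrum (𝓞 ↥(maximalRealSubfield L))) {x y : LocalRing L v} (hx : IsUnit x)
    (h : ∀ w' : PlacesOver L v, Valued.v (y w') = Valued.v (x w')) : IsUnit y := by
  have hy : ∀ w', y w' ≠ 0 := fun w' => (Valuation.ne_zero_iff _).1 ((h w').symm ▸ valued_apply_ne_zero_of_isUnit L v hx w')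
  exact isUnit_iff_exists_inv.2 ⟨fun w' => (y w')⁻¹, funext fun w' => mul_inv_cancel₀ (hy w')⟩

omit [IsCMField L] in
/-- **`|u| = |u′|` for units with the same valuation vector**: `|u| = ∏_w ‖u_w‖_w` (★ `unitModulusChar_localRing_eq_prod`) and `‖x‖_w = q_w^{−n}` iff
`v_w(x) = exp(n)` (★ `normAbs_eq_inv_zpow_of_valued_eq`). [cite: WeilBNT1967, Ch. I §2, §4 Th. 6] -/
theorem distribHaarChar_congr_of_valued_eq (v : HeightOneSpectrum (𝓞 ↥(maximalRealSubfield L))) (u u' : (LocalRing L v)ˣ)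
    (h : ∀ w' : PlacesOver L v, Valued.v ((u : LocalRing L v) w') = Valued.v ((u' : LocalRing L v) w')) :
    (letI : MeasurableSpace (LocalRing L v) := borel _; haveI : BorelSpace (LocalRing L v) := ⟨rfl⟩
      distribHaarChar (LocalRing L v) u) =
    (letI : MeasurableSpace (LocalRing L v) := borel _; haveI : BorelSpace (LocalRing L v) := ⟨rfl⟩
      distribHaarChar (LocalRing L v) u') := by
  letI : MeasurableSpace (LocalRing L v) := borel _
  haveI : BorelSpace (LocalRing L v) := ⟨rfl⟩
  rw [show distribHaarChar (LocalRing L v) u = unitModulusChar (LocalRing L v) u from rfl,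
    show distribHaarChar (LocalRing L v) u' = unitModulusChar (LocalRing L v) u' from rfl,
    unitModulusChar_localRing_eq_prod, unitModulusChar_localRing_eq_prod]
  refine Finset.prod_congr rfl fun w' _ => ?_
  have hne : Valued.v ((u : LocalRing L v) w') ≠ 0 := valued_apply_ne_zero_of_isUnit L v u.isUnit w'
  have hu : Valued.v ((u : LocalRing L v) w') = WithZero.exp (WithZero.log (Valued.v ((u : LocalRing L v) w'))) := (WithZero.exp_log hne).symm
  have hu' : Valued.v ((u' : LocalRing L v) w') = WithZero.exp (WithZero.log (Valued.v ((u : LocalRing L v) w'))) := (h w').symm.trans hu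
  rw [normAbs_eq_inv_zpow_of_valued_eq (v := w'.1) hu, normAbs_eq_inv_zpow_of_valued_eq (v := w'.1) hu']

/-- **`χ⁻(b) = χ⁻(b′)` for `σ`-fixed units with the same valuation vector** (`χ⁻ = √|·|`, ★ `skewModulus_eq_sqrt` with a skew unit ★ `exists_conjLocal_skew_unit`).
[cite: Rogawski1990, §4.9 (4.9.2) p. 56] [cite: WeilBNT1967, Ch. I §4 Th. 6] -/
theorem skewModulus_congr_of_valued_eq (v : HeightOneSpectrum (𝓞 ↥(maximalRealSubfield L))) {b b' : (LocalRing L v)ˣ}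
    (hb : (conjLocal L (IsCMField.complexConj L) v) (b : LocalRing L v) = b) (hb' : (conjLocal L (IsCMField.complexConj L) v) (b' : LocalRing L v) = b')
    (h : ∀ w' : PlacesOver L v, Valued.v ((b : LocalRing L v) w') = Valued.v ((b' : LocalRing L v) w')) :
    (letI : MeasurableSpace (LocalRing L v) := borel _; haveI : BorelSpace (LocalRing L v) := ⟨rfl⟩
          haveI : SecondCountableTopology (LocalRing L v) := secondCountableTopology_localRing (E := L) v
      HeisRing.skewModulus (conjLocal L (IsCMField.complexConj L) v) (continuous_conjLocal L (IsCMField.complexConj L) v) b hb) =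
    (letI : MeasurableSpace (LocalRing L v) := borel _; haveI : BorelSpace (LocalRing L v) := ⟨rfl⟩
          haveI : SecondCountableTopology (LocalRing L v) := secondCountableTopology_localRing (E := L) v
      HeisRing.skewModulus (conjLocal L (IsCMField.complexConj L) v) (continuous_conjLocal L (IsCMField.complexConj L) v) b' hb') := by
  letI : MeasurableSpace (LocalRing L v) := borel _
  haveI : BorelSpace (LocalRing L v) := ⟨rfl⟩
  haveI : SecondCountableTopology (LocalRing L v) := secondCountableTopology_localRing (E := L) v
  obtain ⟨δ, hδ⟩ := exists_conjLocal_skew_unit L v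
  have h2 : IsUnit (2 : LocalRing L v) :=
    isUnit_iff_exists_inv.2 ⟨fun w' => (2 : w'.1.adicCompletion L)⁻¹, funext fun _ => mul_inv_cancel₀ two_ne_zero⟩
  letI : Invertible (2 : LocalRing L v) := h2.invertible
  rw [HeisRing.skewModulus_eq_sqrt (conjLocal L (IsCMField.complexConj L) v) (conjLocal_conjLocal_cm L v) (continuous_conjLocal L (IsCMField.complexConj L) v) δ hδ,
    HeisRing.skewModulus_eq_sqrt (conjLocal L (IsCMField.complexConj L) v) (conjLocal_conjLocal_cm L v) (continuous_conjLocal L (IsCMField.complexConj L) v) δ hδ,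
    distribHaarChar_congr_of_valued_eq L v b b' h]

/-! ## §2 The canonical diagonal writing of a torus element and the local constancy of the valuation vectors of `d₀⁻¹dⱼ − 1` -/

/-- **`t = diag(torusEntry · t)`** — the canonical diagonal writing of `t ∈ M`. [cite: Rogawski1990, §1.10 p. 9] -/
theorem glDiagonal_torusEntry_eq (v : HeightOneSpectrum (𝓞 ↥(maximalRealSubfield L))) (t : ↥(cmBorelTriple L 3 v).M) :
    glDiagonal 3 (LocalRing L v) (fun i : Fin 3 => torusEntry (conjLocal L (IsCMField.complexConj L) v) (cmLocalForm L 3 v) i t) = ((t : ↥(unitaryGroupOfForm (conjLocal L (IsCMField.complexConj L) v) (cmLocalForm L 3 v))) : GL (Fin 3) (LocalRing L v)) := by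
  obtain ⟨d, hd⟩ := (mem_torusU_iff (t : ↥(unitaryGroupOfForm (conjLocal L (IsCMField.complexConj L) v) (cmLocalForm L 3 v)))).1 t.2
  have hdd : (fun i : Fin 3 => torusEntry (conjLocal L (IsCMField.complexConj L) v) (cmLocalForm L 3 v) i t) = d := funext fun i => torusEntry_eq_of_glDiagonal_eq (conjLocal L (IsCMField.complexConj L) v) (cmLocalForm L 3 v) i t d hd
  rw [hdd, hd]

/-- Any diagonal writing of `t ∈ M` is the canonical one. [cite: Rogawski1990, §1.10 p. 9] -/
theorem eq_torusEntry_of_glDiagonal_eq (v : HeightOneSpectrum (𝓞 ↥(maximalRealSubfield L))) (t : ↥(cmBorelTriple L 3 v).M) (d : Fin 3 → (LocalRing L v)ˣ)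
    (hd : glDiagonal 3 (LocalRing L v) d = ((t : ↥(unitaryGroupOfForm (conjLocal L (IsCMField.complexConj L) v) (cmLocalForm L 3 v))) : GL (Fin 3) (LocalRing L v))) : d = (fun i : Fin 3 => torusEntry (conjLocal L (IsCMField.complexConj L) v) (cmLocalForm L 3 v) i t) :=
  funext fun i => (torusEntry_eq_of_glDiagonal_eq (conjLocal L (IsCMField.complexConj L) v) (cmLocalForm L 3 v) i t d hd).symm

/-- **The valuation vector of `dᵢ(t)⁻¹dⱼ(t) − 1` is locally constant at a point where it is a unit** (continuity ★ `continuous_coe_torusEntry_inv_mul` and Mathlib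
`Valued.locally_const`, place by place). [cite: Rogawski1990, §4.9 p. 55] -/
theorem eventually_valued_torusRatio_sub_one_eq (v : HeightOneSpectrum (𝓞 ↥(maximalRealSubfield L))) (i j : Fin 3) (t₀ : ↥(cmBorelTriple L 3 v).M)
    (h0 : IsUnit ((((torusEntry (conjLocal L (IsCMField.complexConj L) v) (cmLocalForm L 3 v) i t₀)⁻¹ * torusEntry (conjLocal L (IsCMField.complexConj L) v) (cmLocalForm L 3 v) j t₀ : (LocalRing L v)ˣ) : LocalRing L v) - 1)) :
    ∀ᶠ t : ↥(cmBorelTriple L 3 v).M in 𝓝 t₀, ∀ w' : PlacesOver L v, Valued.v (((((torusEntry (conjLocal L (IsCMField.complexConj L) v) (cmLocalForm L 3 v) i t)⁻¹ * torusEntry (conjLocal L (IsCMField.complexConj L) v) (cmLocalForm L 3 v) j t : (LocalRing L v)ˣ) : LocalRing L v) - 1) w') = Valued.v (((((torusEntry (conjLocal L (IsCMField.complexConj L) v) (cmLocalForm L 3 v) i t₀)⁻¹ * torusEntry (conjLocal L (IsCMField.complexConj L) v) (cmLocalForm L 3 v) j t₀ : (LocalRing L v)ˣ) : LocalRing L v)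 - 1) w') := by
  have hc : Continuous fun t : ↥(cmBorelTriple L 3 v).M => ((((torusEntry (conjLocal L (IsCMField.complexConj L) v) (cmLocalForm L 3 v) i t)⁻¹ * torusEntry (conjLocal L (IsCMField.complexConj L) v) (cmLocalForm L 3 v) j t : (LocalRing L v)ˣ) : LocalRing L v) - 1) :=
    (continuous_coe_torusEntry_inv_mul (conjLocal L (IsCMField.complexConj L) v) (cmLocalForm L 3 v) i j).sub continuous_const
  rw [Filter.eventually_all]
  intro w'
  have hne := valued_apply_ne_zero_of_isUnit L v h0 w'
  have hmem := Valued.locally_const (R := w'.1.adicCompletion L) hne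
  exact ((continuous_apply w').comp hc).continuousAt.preimage_mem_nhds hmem

/-! ## §3 `δ_B^{1/2}` is locally constant on `M` -/

set_option maxHeartbeats 1600000 in
set_option synthInstance.maxHeartbeats 400000 in
/-- **`δ_B^{1/2}(t) = δ_B^{1/2}(t₀)` for `t` near `t₀` in `M`**: `δ = 1` on the compact subgroup `B ∩ K_v` (★ `rootDeltaChar_borel_eq_one_of_mem_isCompact`, `K_v` compact
open ★ `isCompact_isOpen_cmLocalIntegralLevel`), and `t = t₀ · (t₀⁻¹t)` with `t₀⁻¹t ∈ K_v` near `t₀`. [cite: Rogawski1990, §12.1 p. 171; §4.9 p. 55] -/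
theorem eventually_rootDeltaChar_eq (v : HeightOneSpectrum (𝓞 ↥(maximalRealSubfield L))) (t₀ : ↥(cmBorelTriple L 3 v).M) :
    haveI := locallyCompactSpace_cmBorelU L 3 v
    ∀ᶠ t : ↥(cmBorelTriple L 3 v).M in 𝓝 t₀, ((rootDeltaChar (cmBorelTriple L 3 v).P ⟨(t : ↥(unitaryGroupOfForm (conjLocal L (IsCMField.complexConj L) v) (cmLocalForm L 3 v))), (cmBorelTriple L 3 v).M_le t.2⟩ : ℂˣ) : ℂ) = ((rootDeltaChar (cmBorelTriple L 3 v).P ⟨(t₀ : ↥(unitaryGroupOfForm (conjLocal L (IsCMField.complexConj L) v) (cmLocalForm L 3 v))), (cmBorelTriple L 3 v).M_le t₀.2⟩ : ℂˣ) : ℂ) := by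
  haveI := locallyCompactSpace_cmBorelU L 3 v
  obtain ⟨hKc, hKo⟩ := isCompact_isOpen_cmLocalIntegralLevel L 3 (Matrix.of fun i j : Fin 3 => if i.val + j.val + 1 = 3 then (1 : L) else 0) v
  -- `{t | t₀⁻¹ t ∈ K_v}` is a neighbourhood of `t₀`
  have hc : Continuous fun t : ↥(cmBorelTriple L 3 v).M => (((t₀⁻¹ * t : ↥(cmBorelTriple L 3 v).M) : ↥(unitaryGroupOfForm (conjLocal L (IsCMField.complexConj L) v) (cmLocalForm L 3 v)))) := continuous_subtype_val.comp (continuous_const.mul continuous_id)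
  have h1 : ((t₀⁻¹ * t₀ : ↥(cmBorelTriple L 3 v).M) : ↥(unitaryGroupOfForm (conjLocal L (IsCMField.complexConj L) v) (cmLocalForm L 3 v))) ∈ cmLocalIntegralLevel L 3 (Matrix.of fun i j : Fin 3 => if i.val + j.val + 1 = 3 then (1 : L) else 0) v := by
    rw [inv_mul_cancel]; exact Subgroup.one_mem _
  have hmem : {t : ↥(cmBorelTriple L 3 v).M | ((t₀⁻¹ * t : ↥(cmBorelTriple L 3 v).M) : ↥(unitaryGroupOfForm (conjLocal L (IsCMField.complexConj L) v) (cmLocalForm L 3 v))) ∈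
      cmLocalIntegralLevel L 3 (Matrix.of fun i j : Fin 3 => if i.val + j.val + 1 = 3 then (1 : L) else 0) v} ∈ 𝓝 t₀ :=
    hc.continuousAt.preimage_mem_nhds (hKo.mem_nhds h1)
  filter_upwards [hmem] with t ht
  -- `δ(t) = δ(t₀) · δ(t₀⁻¹ t)` and `δ(t₀⁻¹ t) = 1`
  set p : ↥(cmBorelTriple L 3 v).P := ⟨(t : ↥(unitaryGroupOfForm (conjLocal L (IsCMField.complexConj L) v) (cmLocalForm L 3 v))), (cmBorelTriple L 3 v).M_le t.2⟩ with hp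
  set p₀ : ↥(cmBorelTriple L 3 v).P := ⟨(t₀ : ↥(unitaryGroupOfForm (conjLocal L (IsCMField.complexConj L) v) (cmLocalForm L 3 v))), (cmBorelTriple L 3 v).M_le t₀.2⟩ with hp₀
  set s : ↥(cmBorelTriple L 3 v).P := ⟨(((t₀⁻¹ * t : ↥(cmBorelTriple L 3 v).M) : ↥(unitaryGroupOfForm (conjLocal L (IsCMField.complexConj L) v) (cmLocalForm L 3 v)))), (cmBorelTriple L 3 v).M_le (t₀⁻¹ * t).2⟩ with hs
  have hsplit : p = p₀ * s := by
    apply Subtype.ext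
    change (t : ↥(unitaryGroupOfForm (conjLocal L (IsCMField.complexConj L) v) (cmLocalForm L 3 v))) = (t₀ : ↥(unitaryGroupOfForm (conjLocal L (IsCMField.complexConj L) v) (cmLocalForm L 3 v))) * (((t₀⁻¹ * t : ↥(cmBorelTriple L 3 v).M) : ↥(unitaryGroupOfForm (conjLocal L (IsCMField.complexConj L) v) (cmLocalForm L 3 v))))
    rw [Subgroup.coe_mul, Subgroup.coe_inv, mul_inv_cancel_left]
  have hone : rootDeltaChar (cmBorelTriple L 3 v).P s = 1 :=
    rootDeltaChar_borel_eq_one_of_mem_isCompact (conjLocal L (IsCMField.complexConj L) v) (cmLocalForm L 3 v) (cmLocalForm_eq_over L 3 v) hKc s ht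
  have hmul : rootDeltaChar (cmBorelTriple L 3 v).P p = rootDeltaChar (cmBorelTriple L 3 v).P p₀ * rootDeltaChar (cmBorelTriple L 3 v).P s := by
    rw [hsplit]; exact MonoidHom.map_mul _ _ _
  rw [hmul, hone, mul_one]

/-! ## §4 THE PRODUCER -/

set_option maxHeartbeats 3200000 in
set_option synthInstance.maxHeartbeats 400000 in
/-- **(B-ii) THE LOCALLY CONSTANT, COMPACTLY SUPPORTED REPRESENTATIVE OF THE NORMALISED CANONICAL ORBITAL INTEGRAL ON THE SPLIT TORUS.**  Binders of ★ (4.9.4); `f ∈ C_c^∞`;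
`S ⊆ M` compact with: `e t` regular and `d₀⁻¹d₁ − 1`, `d₀⁻¹d₂ − 1` units for `t ∈ S`, and no conjugate of `e t` in `tsupport f` for `t ∉ S`.  Then there is
`Ψ : M → ℂ`, LOCALLY CONSTANT and COMPACTLY SUPPORTED, with `Ψ(t) = δ_B^{1/2}(t) · J₃(t,d)⁻¹ · O_{⟦e t⟧}(f)` for EVERY `t ∈ M` and EVERY diagonal writing `d` of `t` at which
`J₃(t,d)` is defined — verbatim the Φ-clause of ★ `smoothTrace_cmPrincipalSeries_map_symm_eq_inv_mul_integral` without the character, i.e. the data `Ψ hΨlc hΨK hΨ` (and `hpt`)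
of ★ `normalizedOrbitalIntegral_eq_twoCoset` ∕ ★ `classOrbitalIntegral_mk_eq_twoCoset`. [cite: Rogawski1990, §4.9 pp. 55–56; §12.5 p. 183] [cite: HarishChandra1970, Part V §§2–3] -/
theorem exists_normalizedOrbitalIntegral_isLocallyConstant_hasCompactSupport
    (H : Matrix (Fin 3) (Fin 3) L) (hH : (H.map (IsCMField.complexConj L))ᵀ = H) (hHd : IsUnit H.det)
    {v : HeightOneSpectrum (𝓞 ↥(maximalRealSubfield L))} (w : PlacesOver L v) (hw : IsCMField.complexConj L • w.1 = w.1)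
    (T : GL (Fin 3) (LocalRing L v)) {a : LocalRing L v} (ha : IsUnit a)
    (h : formCongr (conjLocal L (IsCMField.complexConj L) v) T (H.map (algebraMap L (LocalRing L v))) =
      a • (Matrix.of fun i j : Fin 3 => if i.val + j.val + 1 = 3 then (1 : L) else 0).map (algebraMap L (LocalRing L v)))
    [MeasurableSpace ((cmDatum L 3 H).Local v)] [BorelSpace ((cmDatum L 3 H).Local v)]
    [∀ γ : (cmDatum L 3 H).Local v, MeasurableSpace (((cmDatum L 3 H).Local v) ⧸ Subgroup.centralizer ({γ} : Set ((cmDatum L 3 H).Local v)))]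
    [∀ γ : (cmDatum L 3 H).Local v, BorelSpace (((cmDatum L 3 H).Local v) ⧸ Subgroup.centralizer ({γ} : Set ((cmDatum L 3 H).Local v)))]
    (νG : Measure ((cmDatum L 3 H).Local v)) [νG.IsHaarMeasure] [νG.IsMulRightInvariant]
    {mG : OrbitalMeasureFamily ((cmDatum L 3 H).Local v)}
    (hmG : mG.IsCanonical (fun γ => IsRegularElt (γ.val : GL (Fin 3) (LocalRing L v))) νG)
    {f : ((cmDatum L 3 H).Local v) → ℂ} (hf : IsLocSmooth f)
    (S : Set ↥(cmBorelTriple L 3 v).M) (hSc : IsCompact S)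
    (hSreg : ∀ t ∈ S, IsRegularElt ((Subtype.val ((cmDatumLocalCongr L v T ha h) (t : ↥(unitaryGroupOfForm (conjLocal L (IsCMField.complexConj L) v) (cmLocalForm L 3 v))))) : GL (Fin 3) (LocalRing L v)))
    (hSunit : ∀ t ∈ S, ∀ d : Fin 3 → (LocalRing L v)ˣ, glDiagonal 3 (LocalRing L v) d = ((t : ↥(unitaryGroupOfForm (conjLocal L (IsCMField.complexConj L) v) (cmLocalForm L 3 v))) : GL (Fin 3) (LocalRing L v)) →
      IsUnit ((((d 0)⁻¹ * d 1 : (LocalRing L v)ˣ) : LocalRing L v) - 1) ∧ IsUnit ((((d 0)⁻¹ * d 2 : (LocalRing L v)ˣ) : LocalRing L v) - 1))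
    (hSoff : ∀ t : ↥(cmBorelTriple L 3 v).M, t ∉ S → ∀ x : ((cmDatum L 3 H).Local v), x * (cmDatumLocalCongr L v T ha h) (t : ↥(unitaryGroupOfForm (conjLocal L (IsCMField.complexConj L) v) (cmLocalForm L 3 v))) * x⁻¹ ∉ tsupport f) :
    haveI := locallyCompactSpace_cmBorelU L 3 v
    ∃ Ψ : ↥(cmBorelTriple L 3 v).M → ℂ, IsLocallyConstant Ψ ∧ HasCompactSupport Ψ ∧
      ∀ (t : ↥(cmBorelTriple L 3 v).M) (d : Fin 3 → (LocalRing L v)ˣ)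
      (hd : glDiagonal 3 (LocalRing L v) d = ((t : ↥(unitaryGroupOfForm (conjLocal L (IsCMField.complexConj L) v) (cmLocalForm L 3 v))) : GL (Fin 3) (LocalRing L v)))
      (ha' : IsUnit ((((d 0)⁻¹ * d 1 : (LocalRing L v)ˣ) : LocalRing L v) - 1))
      (hb' : IsUnit ((((d 0)⁻¹ * d 2 : (LocalRing L v)ˣ) : LocalRing L v) - 1)),
      Ψ t =
          ((rootDeltaChar (cmBorelTriple L 3 v).P ⟨(t : ↥(unitaryGroupOfForm (conjLocal L (IsCMField.complexConj L) v) (cmLocalForm L 3 v))), (cmBorelTriple L 3 v).M_le t.2⟩ : ℂˣ) : ℂ) *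
        ((((letI : MeasurableSpace (LocalRing L v) := borel _; haveI : BorelSpace (LocalRing L v) := ⟨rfl⟩
          haveI : SecondCountableTopology (LocalRing L v) := secondCountableTopology_localRing (E := L) v
          ((distribHaarChar (LocalRing L v) ha'.unit)⁻¹ *
            (HeisRing.skewModulus (conjLocal L (IsCMField.complexConj L) v) (continuous_conjLocal L (IsCMField.complexConj L) v) hb'.unit
              (HeisRing.map_unit_torusCentralScalar_sub_one (conjLocal L (IsCMField.complexConj L) v) (cmLocalForm_eq_over L 3 v) t hd hb'))⁻¹ : ℝ≥0))) : ℝ) : ℂ)⁻¹ *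
        classOrbitalIntegral mG f (ConjClasses.mk ((cmDatumLocalCongr L v T ha h) (t : ↥(unitaryGroupOfForm (conjLocal L (IsCMField.complexConj L) v) (cmLocalForm L 3 v))))) := by
  classical
  haveI := locallyCompactSpace_cmBorelU L 3 v
  set Ψ : ↥(cmBorelTriple L 3 v).M → ℂ := fun t =>
      ((rootDeltaChar (cmBorelTriple L 3 v).P ⟨(t : ↥(unitaryGroupOfForm (conjLocal L (IsCMField.complexConj L) v) (cmLocalForm L 3 v))), (cmBorelTriple L 3 v).M_le t.2⟩ : ℂˣ) : ℂ) *
        (if hu : IsUnit ((((torusEntry (conjLocal L (IsCMField.complexConj L) v) (cmLocalForm L 3 v) 0 t)⁻¹ * torusEntry (conjLocal L (IsCMField.complexConj L) v) (cmLocalForm L 3 v) 1 t : (LocalRing L v)ˣ) : LocalRing L v) - 1) ∧ IsUnit ((((torusEntry (conjLocal L (IsCMField.complexConj L) v) (cmLocalForm L 3 v) 0 t)⁻¹ * torusEntry (conjLocal L (IsCMField.complexConj L) v) (cmLocalForm L 3 v) 2 t : (LocalRing L v)ˣ) : LocalRing L v) - 1) then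
          ((((letI : MeasurableSpace (LocalRing L v) := borel _; haveI : BorelSpace (LocalRing L v) := ⟨rfl⟩
          haveI : SecondCountableTopology (LocalRing L v) := secondCountableTopology_localRing (E := L) v
          ((distribHaarChar (LocalRing L v) hu.1.unit)⁻¹ *
            (HeisRing.skewModulus (conjLocal L (IsCMField.complexConj L) v) (continuous_conjLocal L (IsCMField.complexConj L) v) hu.2.unit
              (HeisRing.map_unit_torusCentralScalar_sub_one (conjLocal L (IsCMField.complexConj L) v) (cmLocalForm_eq_over L 3 v) t (glDiagonal_torusEntry_eq L v t) hu.2))⁻¹ : ℝ≥0))) : ℝ) : ℂ)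
         else 1)⁻¹ *
        classOrbitalIntegral mG f (ConjClasses.mk ((cmDatumLocalCongr L v T ha h) (t : ↥(unitaryGroupOfForm (conjLocal L (IsCMField.complexConj L) v) (cmLocalForm L 3 v))))) with hΨdef
  -- off `S` the orbital integral, hence `Ψ`, vanishes
  have hzero : ∀ t : ↥(cmBorelTriple L 3 v).M, t ∉ S → Ψ t = 0 := by
    intro t ht
    have hO : classOrbitalIntegral mG f (ConjClasses.mk ((cmDatumLocalCongr L v T ha h) (t : ↥(unitaryGroupOfForm (conjLocal L (IsCMField.complexConj L) v) (cmLocalForm L 3 v))))) = 0 := classOrbitalIntegral_mk_eq_zero_of_forall_conj_notMem_tsupport mG (hSoff t ht)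
    simp only [hΨdef, hO, mul_zero]
  -- on `S` every factor is eventually constant
  have hloc : ∀ t₀ ∈ S, ∀ᶠ t : ↥(cmBorelTriple L 3 v).M in 𝓝 t₀, Ψ t = Ψ t₀ := by
    intro t₀ ht₀
    obtain ⟨ha₀, hb₀⟩ := hSunit t₀ ht₀ _ (glDiagonal_torusEntry_eq L v t₀)
    have hO := eventually_classOrbitalIntegral_congr_eq L H hH hHd w hw T ha h νG hmG hf t₀ (hSreg t₀ ht₀)
    have hδ := eventually_rootDeltaChar_eq L v t₀
    have h01 := eventually_valued_torusRatio_sub_one_eq L v 0 1 t₀ ha₀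
    have h02 := eventually_valued_torusRatio_sub_one_eq L v 0 2 t₀ hb₀
    filter_upwards [hO, hδ, h01, h02] with t htO htδ ht01 ht02
    have ha₁ : IsUnit ((((torusEntry (conjLocal L (IsCMField.complexConj L) v) (cmLocalForm L 3 v) 0 t)⁻¹ * torusEntry (conjLocal L (IsCMField.complexConj L) v) (cmLocalForm L 3 v) 1 t : (LocalRing L v)ˣ) : LocalRing L v) - 1) := isUnit_of_valued_apply_eq L v ha₀ ht01
    have hb₁ : IsUnit ((((torusEntry (conjLocal L (IsCMField.complexConj L) v) (cmLocalForm L 3 v) 0 t)⁻¹ * torusEntry (conjLocal L (IsCMField.complexConj L) v) (cmLocalForm L 3 v) 2 t : (LocalRing L v)ˣ) : LocalRing L v) - 1) := isUnit_of_valued_apply_eq L v hb₀ ht02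
    have hJ : (letI : MeasurableSpace (LocalRing L v) := borel _; haveI : BorelSpace (LocalRing L v) := ⟨rfl⟩
          haveI : SecondCountableTopology (LocalRing L v) := secondCountableTopology_localRing (E := L) v
          ((distribHaarChar (LocalRing L v) ha₁.unit)⁻¹ *
            (HeisRing.skewModulus (conjLocal L (IsCMField.complexConj L) v) (continuous_conjLocal L (IsCMField.complexConj L) v) hb₁.unit
              (HeisRing.map_unit_torusCentralScalar_sub_one (conjLocal L (IsCMField.complexConj L) v) (cmLocalForm_eq_over L 3 v) t (glDiagonal_torusEntry_eq L v t) hb₁))⁻¹ : ℝ≥0)) =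
        (letI : MeasurableSpace (LocalRing L v) := borel _; haveI : BorelSpace (LocalRing L v) := ⟨rfl⟩
          haveI : SecondCountableTopology (LocalRing L v) := secondCountableTopology_localRing (E := L) v
          ((distribHaarChar (LocalRing L v) ha₀.unit)⁻¹ *
            (HeisRing.skewModulus (conjLocal L (IsCMField.complexConj L) v) (continuous_conjLocal L (IsCMField.complexConj L) v) hb₀.unit
              (HeisRing.map_unit_torusCentralScalar_sub_one (conjLocal L (IsCMField.complexConj L) v) (cmLocalForm_eq_over L 3 v) t₀ (glDiagonal_torusEntry_eq L v t₀) hb₀))⁻¹ : ℝ≥0)) := by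
      have h1 := distribHaarChar_congr_of_valued_eq L v ha₁.unit ha₀.unit (fun w' => by rw [IsUnit.unit_spec, IsUnit.unit_spec]; exact ht01 w')
      have h2 := skewModulus_congr_of_valued_eq L v
        (HeisRing.map_unit_torusCentralScalar_sub_one (conjLocal L (IsCMField.complexConj L) v) (cmLocalForm_eq_over L 3 v) t (glDiagonal_torusEntry_eq L v t) hb₁)
        (HeisRing.map_unit_torusCentralScalar_sub_one (conjLocal L (IsCMField.complexConj L) v) (cmLocalForm_eq_over L 3 v) t₀ (glDiagonal_torusEntry_eq L v t₀) hb₀)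
        (fun w' => by rw [IsUnit.unit_spec, IsUnit.unit_spec]; exact ht02 w')
      rw [h1, h2]
    simp only [hΨdef]
    rw [dif_pos ⟨ha₁, hb₁⟩, dif_pos ⟨ha₀, hb₀⟩, htO, htδ, hJ]
  have hglue := Literature.Topology.isLocallyConstant_and_hasCompactSupport_of_eventually_eq_of_eq_zero_off (U := S) (K := S)
    hloc hzero hSc hSc.isClosed subset_rfl
  refine ⟨Ψ, hglue.1, hglue.2, fun t d hd ha' hb' => ?_⟩
  obtain rfl := eq_torusEntry_of_glDiagonal_eq L v t d hd
  simp only [hΨdef]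
  rw [dif_pos ⟨ha', hb'⟩]

end Summit.HodgeConjecture.HodgeConjecture.Cruxes.H413.F0P3cStCharTSShellOrbitalG

end
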